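import Summits.CriticalPhenomena.PercolationContinuityZ3.Theorems.Transplant.CayleyMilnorTransitive
import Summits.CriticalPhenomena.PercolationContinuityZ3.Theorems.Transplant.PlanarSkeletonFrmScaledBoxProd
import HarnessLib

/-!
# Milnor's kernel lemma, V: products `X □ G` — `X` vertex-transitive, `G` with a transitive finite-stabiliser group of automorphisms mapping onto a
# rank-2 subgroup of `ℤ²` (modulo the one-type scaled node ALONE)

builds on p205010 (kernel theorem, internal audit signed; external expert review pending) — nothing in this file uses p205010.  The theorem is
CONDITIONAL on the OPEN node `SamePDropOfSkeletonFrmScaled₁` (hypothesis `hN`; nothing is claimed about it) and on NOTHING ELSE.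
Lane `prim-bschramm`, seat `prim-bschramm-p4` gen 17 (PART C3 of `P4-GENERAL.md` §39.8).  Helper file (`--supports stmt-CriticalPhenomena-4575`).

The product row of the chart-free theorem (file IV, `AutScaled.criticalContinuity`): for every connected locally finite vertex-transitive `X` (frames only by
existence, `PlanarSkeletonFrmScaled.boxProdLeft`) and every connected locally finite `G` carrying a transitive action by automorphisms with finite vertex
stabiliser and a rank-2 homomorphism to `ℤ²`, `θ_v(p_c(X □ G)) = 0` at every vertex.  ON exponential growth of `Cay(A; S_A)`: `G`, hence `G □ X`, hence
(by `boxProdComm`) `X □ G` grows exponentially and Hutchcroft applies; OFF it: `AutScaled.skeleton` of `G` and gen 16's `boxProd_continuity_of_frmScaledNode₁`.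
[cite: BenjaminiSchramm1996, Conj. 4; §2 (almost transitive graphs)] [cite: Hutchcroft2016, Thm. 1.1] [cite: MilnorSolvableGrowth1968, Lemma 1]
-/

noncomputable section

namespace Summit.CriticalPhenomena.PercolationContinuityZ3.Theorems.Transplant

open SimpleGraph Filter Literature.Barriers.CriticalPhenomena Literature.Probability.LatticeModels Literature.Probability.Percolation
open scoped Classical

namespace AutScaled

variable {W V : Type} {G : SimpleGraph V} [G.LocallyFinite] {A : Type} [Group A] [MulAction A V]

/-- **THEOREM (modulo the scaled node ALONE): `θ_v(p_c(X □ G)) = 0` at every vertex** for every connected locally finite vertex-transitive `X` and every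
connected locally finite `G` with a transitive action by automorphisms, finite stabiliser of `t`, and a homomorphism `A → ℤ²` of rank-2 image.
[cite: BenjaminiSchramm1996, Conj. 4; §2] [cite: Hutchcroft2016, Thm. 1.1] [cite: MilnorSolvableGrowth1968, Lemma 1] -/
theorem boxProd_criticalContinuity (hN : SamePDropOfSkeletonFrmScaled₁) (X : SimpleGraph W) [X.LocallyFinite] (x₀ : W)
    (htrX : ∀ x : W, ∃ γ : X ≃g X, γ x₀ = x) (hcX : X.Connected) (hact : IsActionByAut G A) (hc : G.Connected) (t : V)
    (htr : ∀ v : V, ∃ a : A, a • t = v) (hfin : (MulAction.stabilizer A t : Set A).Finite) (c : A →* Multiplicative (Site 2))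
    (hrank : ∃ a b : A, MaxArea.det2 (Multiplicative.toAdd (c a)) (Multiplicative.toAdd (c b)) ≠ 0) (v : W × V) :
    theta (X □ G) v (criticalProbIOf (X □ G) v) = 0 := by
  by_cases hexp : HasExponentialGrowth (mulCayley (↑(genSet G t hfin) : Set A))
  · haveI : Countable V := countable_of_connected_of_locallyFinite G hc t
    haveI : Countable W := countable_of_connected_of_locallyFinite X hcX x₀
    have hX : IsQuasiTransitive X := ⟨{x₀}, fun x => by
      obtain ⟨γ, hγ⟩ := htrX x
      exact ⟨γ.symm, by rw [← hγ, RelIso.symm_apply_apply]; exact Finset.mem_singleton_self _⟩⟩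
    have hpc : criticalProbIOf (SimpleGraph.boxProd X G) v = criticalProbIOf (SimpleGraph.boxProd G X) (SimpleGraph.boxProdComm X G v) :=
      Subtype.ext (criticalProb_iso (SimpleGraph.boxProdComm X G) v).symm
    rw [hpc, ← theta_iso (SimpleGraph.boxProdComm X G) v]
    exact Hutchcroft2016_noPercolationAtCriticality_holds _ (hc.boxProd hcX)
      (isQuasiTransitive_boxProd (isQuasiTransitive_of_action hact htr) hX)
      (hasExponentialGrowth_boxProd_left X (hasExponentialGrowth_of_cayley hact htr hfin hexp)) _
  · have hS := closure_genSet hact hc htr hfin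
    exact PlanarSkeletonFrmScaled.boxProd_continuity_of_frmScaledNode₁ hN X x₀ htrX hcX
      (skeleton hact htr (CayleyScaled.ofKerFG c hrank (Milnor.ker_fg_of_not_hasExponentialGrowth _ hS hexp c) (genSet G t hfin) hS))
      t (Finset.mem_singleton_self t) rfl v

end AutScaled

end Summit.CriticalPhenomena.PercolationContinuityZ3.Theorems.Transplant

end
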